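import Literature.MathematicalPhysics.QuantumFieldTheory.Balaban1983to89.B12Eq338CondIV
import Literature.MathematicalPhysics.QuantumFieldTheory.Balaban1983to89.B12Lemma4Space

/-!
# `Balaban1983to89.B12Lemma4CondIV` — T. Bałaban, *Renormalization group approach to lattice gauge field theories. I*,
Commun. Math. Phys. **109** (1987) 249–301 [Balaban1987RG1]: **(3.52) p. 280 AS PRINTED, the J-budget below the same count, and Lemma 4
(3.53) on the concrete space with condition (iv) DERIVED from the identity (3.38)** — until now (3.52) existed in the tree only in its
closed form `< α₀ξ²` (`B12Plaquette343.condIII_first_plaquette_shifted`, `B12Lemma4Concrete.condIII_first_plaq/_region`), and condition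
(iv) for the Lemma-4 configuration and for its factor `U = 1` were the hypotheses `hIV`, `hIV₁` of `B12Lemma4Space.mem_space'_lemma4` /
`ofBackground_mem_space'_lemma4` (and of `B12Lemma4Chain`, `B12Lemma4Models`).

HONEST FRAMING (cell `lit-balaban`, verbatim): statement-level skeleton of published theorems with citation tags; proofs where landed; nothing here is a claim about the Yang–Mills mass gap.

PDF held: `paper:balaban1987-cmp109-rg-i-small-field` (journal page = PDF page + 248); pp. 278, 280 re-read as images from the renders
`b2b-balaban-ref1/pages/1987-cmp109-rg-I-small-field/1987-cmp109-rg-I-small-field-p030/p032-x2.png` by this unit.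

THE PRINT, verbatim (p. 280): *«|∂^ξ𝐇_j(□₀, τQ(L⁻¹η𝐇_{k+1}) + B′)| ≦ |∂^ξ𝐇_j(□₀, τQ(L⁻¹η𝐇_{k+1}))| + |∂^ξ𝐀₂| < (1+6β)α₀(L^{j−1}η)² + 2B₃α₃ ≦
(1+6β)L⁻²α₀ + 2B₃α₃ ≦ (1+7β)L⁻²α₀ on □̃³, (3.51) where we have assumed 2B₃α₃ ≦ βL⁻²α₀. The above inequality, and the inequality (3.43)
slightly modified for the present situation, give the bound |∂ exp iξ𝐇_j(□₀, τQ(L⁻¹η𝐇_{k+1}) + B′) − 1| < (1+8β)L⁻²α₀ξ² on □̃³. (3.52) This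
implies the first inequality in the condition (iii). The second is proved in the same way, as it was already discussed. The condition (iv)
follows from the corresponding identity (3.38). … Lemma 4. For 𝐔 ∈ U′ᶜ_{k+1}(□₀, (1+2β)α₀, (1+2β)α₁), … we have (U_j(□₀, exp i(τB + B′)),
J_j(□₀, exp i(τB + B′)))|_X ∈ U^c_j(X, α₀, α₁) (3.53)»*; p. 278 (3.38) and «the condition (iv) is a consequence of the condition (iii), with
a bit better constant» as quoted in `B12Eq338CondIV`.

THE READING.  (3.52)'s right member `(1+8β)L⁻²α₀ξ²` and the J-budget `(1+3β)α₀x³ + 3βα₀x² + B₃″α₃ + βL⁻²α₀ < (1+8β)L⁻²α₀`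
(`B12CondIIIJ.jBudget_lt`, `x = L^{j−1}η ≤ L⁻¹`) ARE the (iii)-type bounds «with a bit better constant» that the mechanism of (3.38)
(`B12Eq338CondIV.condIV_of_eq338`) turns into condition (iv) with constant `α₀`, once the rotation cost `e^{B₃²O(1)Mα₀}e^{B₃²O(1)Mα₀}` of
`u_j(ū_j)⁻¹` fits: `e^{2B₃²O(1)Mα₀}(1+8β)L⁻²α₀ ≤ α₀` — under «all the restrictions» plus the located extra restriction `1 + 10β ≤ L²`
(`B12Eq338CondIV.margin352_of_restrictions`, GAPS G-B12-03).  Geometry as data: `X̃⁻² ⊆ X` enters as the inclusions of the plaquette and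
bond index sets (`hX₂p`, `hX₂b`).

WHAT IS PROVED.  §1 **(3.52) as printed**: `ineq352_plaquette` (the ordered-exponential reading of `B12Plaquette343`, same inputs as
`condIII_first_plaquette_shifted`, conclusion `< (1+8β)L⁻²α₀ξ²`), `ineq352_plaq` (the plaquette variable of `exp iξ(𝐊 + 𝐀₂)` on the
lattice), `ineq352_region` (on a plaquette set with bond data on a region `Y` = □̃³).  §2 `jBudget_lt_352` (the J-budget is
`< (1+8β)L⁻²α₀`, strictly), `jBudget_lt_352_of_restrictions`.  §3 **`condIV_lemma4_of_eq338`**: condition (iv) of `U^c_j(X, α₀, α₁)` for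
`V = exp iξ(𝐊 + 𝐀₂)` from the Lemma-4 inputs ((3.41) literal, (3.37), (3.45), (3.50)), the J-budget bound for `J(V) = current π ξ V` on
`X̃⁻²`, and the (3.38)-data (`h338`, `hJn`, `u_j` of cost `≤ e^{B₃²O(1)Mα₀}`, `ū_j = u_j ∘ ctr`, `π` commuting with `Ad`), under
`Lemma4Restrictions` + the unlisted constant hypotheses + `1 + 10β ≤ L²`.  §4 **`ofBackground_mem_space'_lemma4_of_eq338`**: Lemma 4, membership
of the printed pair `(V, J(V))` in `U^c_j(X, α₀, α₁)` = `B12Lemma4Space.ofBackground_mem_space'_lemma4` with `hIV`, `hIV₁` and the J-half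
`hJ` DISCHARGED from the (3.38)-data and ONE J-budget hypothesis on `Y`.  NOT here (hypotheses, by reference): the functions `𝐇_j`, `𝐀₂`,
`U_n(X, M˙(·))`, `J_n`, `u_j`, `ū_j` of [14, 15], the identities (3.38), the literal (3.41), the J-budget bound itself (its ladder is
`B12CondIIIJ.jLadder_bound` from undisclosed inputs), analyticity.  No `def`, no `Prop` placeholder, no new fact; axioms standard.
Unit `lit-balaban-p07` (Phase-2 seat p07 gen 6; TAKING line HOME/STATUS.md 2026-08-21T08:17:22Z; rows B12.Eq3.50-3.52 / B12.Lem4, owners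
r09/r20), HOME `run/shared/lean/pub/lit-balaban/`.
-/

namespace Literature.MathematicalPhysics.QuantumFieldTheory.Balaban1983to89.B12Lemma4CondIV

open Literature.MathematicalPhysics.QuantumFieldTheory.Balaban1983to89
open Literature.MathematicalPhysics.QuantumFieldTheory.Balaban1983to89.Beta.TransportVertices
open Literature.MathematicalPhysics.QuantumFieldTheory.Balaban1983to89.B9Eq39Adjoint (R)
open Literature.MathematicalPhysics.QuantumFieldTheory.Balaban1983to89.B12RegularSpaces111
open Literature.MathematicalPhysics.QuantumFieldTheory.Balaban1983to89.B12Plaquette343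
open Literature.MathematicalPhysics.QuantumFieldTheory.Balaban1983to89.B12Lemma4Concrete
open Literature.MathematicalPhysics.QuantumFieldTheory.Balaban1983to89.B12Eq18Current
open Literature.MathematicalPhysics.QuantumFieldTheory.Balaban1983to89.B12Eq338CondIV
open Complex (I)

noncomputable section

variable {P : Params} {i : ℕ} {𝔸 : Type*} [NormedRing 𝔸] [NormedAlgebra ℂ 𝔸] [CompleteSpace 𝔸]

/-! ## §1. (3.52) AS PRINTED: `|∂ exp iξ𝐇_j(□₀, τQ(…) + B′) − 1| < (1+8β)L⁻²α₀ξ²` -/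

/-- **(3.52) as printed, for the ordered exponential of the four bond data `𝐊 + 𝐀₂`** — the inputs are exactly those of
`B12Plaquette343.condIII_first_plaquette_shifted` (the literal first inequality of (3.41), (3.37) at `Q` and `τQ`, (3.45) at both, (3.50),
`|B′| = n < α₃`, `Lemma4Restrictions` + the three unlisted constant hypotheses), the conclusion is the PRINTED right member
`(1+8β)L⁻²α₀ξ²` ((3.51) `deriv_shift_le`/`B12Sec2to5.ineq351` + «(3.43) slightly modified» `elem343_shift` with its budget `budget352`).
[cite: Balaban1987RG1, (3.52) p.280] -/
theorem ineq352_plaquette (c : B12Sec2to5.Lemma4Consts) (hR : B12Sec2to5.Lemma4Restrictions c)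
    (hB : 1 ≤ c.B₃) (hY : 1 ≤ c.B₃ ^ 2 * c.O₁ * c.M) (hα₁ : 16 * (c.O₁ * c.M * c.α₁) ≤ c.β)
    {η ξ τ n : ℝ} {j : ℕ} (hη : 0 ≤ η) (hj : 1 ≤ j) (hscale : c.L ^ j * η ≤ 1)
    (hξ : 0 < ξ) (hξ1 : ξ ≤ 1) (hξx : ξ * (c.L ^ (j - 1) * η) = c.L⁻¹ * η) (hτ0 : 0 ≤ τ) (hτ1 : τ ≤ 1)
    {H₁ H₂ H₃ H₄ K₁ K₂ K₃ K₄ b A₁ A₂ A₃ A₄ : 𝔸}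
    (h41 : ‖holonomy [(I * ξ) • H₁, (I * ξ) • H₂, -((I * ξ) • H₃), -((I * ξ) • H₄)] - 1‖ <
      Real.exp (c.B₃ ^ 2 * c.O₁ * c.M * c.α₀) * Real.exp (c.B₃ * c.O₁ * c.M * c.α₀) *
      Real.exp (c.B₃ * c.O₁ * c.M * c.α₀) * Real.exp (c.O₁ * c.M * c.α₁) *
      ((1 + 2 * c.β) * c.α₀ * (c.L⁻¹ * η) ^ 2))
    (hH₁ : ‖H₁‖ < c.B₃ ^ 2 * c.O₁ * c.M * c.α₀ * (c.L ^ (j - 1) * η))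
    (hH₂ : ‖H₂‖ < c.B₃ ^ 2 * c.O₁ * c.M * c.α₀ * (c.L ^ (j - 1) * η))
    (hH₃ : ‖H₃‖ < c.B₃ ^ 2 * c.O₁ * c.M * c.α₀ * (c.L ^ (j - 1) * η))
    (hH₄ : ‖H₄‖ < c.B₃ ^ 2 * c.O₁ * c.M * c.α₀ * (c.L ^ (j - 1) * η))
    (h45 : ‖(ξ : ℂ)⁻¹ • (H₁ + H₂ - H₃ - H₄) - b‖ <
      c.B₃ * (c.B₃ * c.O₁ * c.M * c.α₀ * (c.L ^ (j - 1) * η)) ^ 2)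
    (hK₁ : ‖K₁‖ < c.B₃ ^ 2 * c.O₁ * c.M * c.α₀ * (c.L ^ (j - 1) * η))
    (hK₂ : ‖K₂‖ < c.B₃ ^ 2 * c.O₁ * c.M * c.α₀ * (c.L ^ (j - 1) * η))
    (hK₃ : ‖K₃‖ < c.B₃ ^ 2 * c.O₁ * c.M * c.α₀ * (c.L ^ (j - 1) * η))
    (hK₄ : ‖K₄‖ < c.B₃ ^ 2 * c.O₁ * c.M * c.α₀ * (c.L ^ (j - 1) * η))
    (h45τ : ‖(ξ : ℂ)⁻¹ • (K₁ + K₂ - K₃ - K₄) - (τ : ℂ) • b‖ <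
      c.B₃ * (c.B₃ * c.O₁ * c.M * c.α₀ * (c.L ^ (j - 1) * η)) ^ 2)
    (hn : n < c.α₃) (hA₁ : ‖A₁‖ ≤ c.B₃ * n) (hA₂ : ‖A₂‖ ≤ c.B₃ * n) (hA₃ : ‖A₃‖ ≤ c.B₃ * n)
    (hA₄ : ‖A₄‖ ≤ c.B₃ * n) (hdμ : ‖(ξ : ℂ)⁻¹ • (A₂ - A₄)‖ ≤ c.B₃ * n) (hdν : ‖(ξ : ℂ)⁻¹ • (A₃ - A₁)‖ ≤ c.B₃ * n) :
    ‖holonomy [(I * ξ) • (K₁ + A₁), (I * ξ) • (K₂ + A₂), -((I * ξ) • (K₃ + A₃)), -((I * ξ) • (K₄ + A₄))] - 1‖ <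
      (1 + 8 * c.β) * c.L⁻¹ ^ 2 * c.α₀ * ξ ^ 2 := by
  have hR' := hR
  unfold B12Sec2to5.Lemma4Restrictions at hR'
  obtain ⟨hα₀, _, _, hα₃, hβ, _, _, hL1, _, hres10, _, _, hres13, _⟩ := hR'
  have hLpos : 0 < c.L := by linarith
  have hξ2 : 0 < ξ ^ 2 := by positivity
  have hB0 : 0 ≤ c.B₃ := by linarith
  -- the B′ = 0 ladder up to "(3.44) with τQ(…), and the factor 1+6β"
  have h44 := ineq344_plaquette c hR hB hY hα₁ hη hj hscale hξ hξx h41 hH₁ hH₂ hH₃ hH₄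
  have h45i := B12CondIIIJ.ineq345_inner (x := c.L ^ (j - 1) * η) hα₀.le hB hres10
  have htri := tri346 ((ξ : ℂ)⁻¹ • (H₁ + H₂ - H₃ - H₄)) ((ξ : ℂ)⁻¹ • (K₁ + K₂ - K₃ - K₄)) b hτ0
  have h46 := B12CondIIIJ.ineq346 htri.1 h44 (lt_of_lt_of_le h45 h45i)
  have h44τ := B12CondIIIJ.ineq344τ hτ0 hτ1 (norm_nonneg b) h46 (lt_of_lt_of_le h45τ h45i) htri.2
  -- (3.51)
  have hnα : c.B₃ * n ≤ c.B₃ * c.α₃ := mul_le_mul_of_nonneg_left hn.le hB0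
  have hdA : ‖(ξ : ℂ)⁻¹ • (A₁ + A₂ - A₃ - A₄)‖ ≤ 2 * (c.B₃ * n) := deriv_A_le ξ A₁ A₂ A₃ A₄ hdμ hdν
  have h351 := B12Sec2to5.ineq351 hLpos hη hj hscale hβ.le hα₀.le hres13
  have h51 : ‖(ξ : ℂ)⁻¹ • ((K₁ + A₁) + (K₂ + A₂) - (K₃ + A₃) - (K₄ + A₄))‖ < (1 + 7 * c.β) * c.L⁻¹ ^ 2 * c.α₀ := by
    have h1 := deriv_shift_le ξ K₁ K₂ K₃ K₄ A₁ A₂ A₃ A₄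
    linarith [h351.1, h351.2]
  -- "(3.43) slightly modified" and its budget
  have hrem := elem343_shift hξ.le hK₁ hK₂ hK₃ hK₄ (hA₁.trans hnα) (hA₂.trans hnα) (hA₃.trans hnα) (hA₄.trans hnα)
  have hbud := budget352_of_restrictions c hR hB hY hη hj hscale hξ.le hξ1
  -- (3.52), printed right member
  have hlin0 := norm_deriv_eq hξ ((K₁ + A₁) + (K₂ + A₂) - (K₃ + A₃) - (K₄ + A₄))
  set W' := holonomy [(I * ξ) • (K₁ + A₁), (I * ξ) • (K₂ + A₂), -((I * ξ) • (K₃ + A₃)),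
    -((I * ξ) • (K₄ + A₄))] with hW'
  set S' := (K₁ + A₁) + (K₂ + A₂) - (K₃ + A₃) - (K₄ + A₄) with hS'
  have hlin : ‖(I * ξ) • S'‖ = ‖(ξ : ℂ)⁻¹ • S'‖ * ξ ^ 2 := by
    rw [hlin0, div_mul_cancel₀ _ hξ2.ne']
  have htri' : ‖W' - 1‖ ≤ ‖(I * ξ) • S'‖ + ‖W' - 1 - (I * ξ) • S'‖ := by
    calc ‖W' - 1‖ = ‖(I * ξ) • S' + (W' - 1 - (I * ξ) • S')‖ := by rw [add_sub_cancel]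
      _ ≤ _ := norm_add_le _ _
  have step1 : ‖(I * ξ) • S'‖ < (1 + 7 * c.β) * c.L⁻¹ ^ 2 * c.α₀ * ξ ^ 2 := by
    rw [hlin]
    exact mul_lt_mul_of_pos_right h51 hξ2
  have step2 : ‖W' - 1 - (I * ξ) • S'‖ < c.β * c.L⁻¹ ^ 2 * c.α₀ * ξ ^ 2 := by
    calc _ ≤ _ := hrem
      _ = 8 * (c.B₃ ^ 2 * c.O₁ * c.M * c.α₀ * (c.L ^ (j - 1) * η) + c.B₃ * c.α₃) ^ 2 *
            Real.exp (4 * ξ * (c.B₃ ^ 2 * c.O₁ * c.M * c.α₀ * (c.L ^ (j - 1) * η) + c.B₃ * c.α₃)) * ξ ^ 2 := by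
          ring
      _ < _ := mul_lt_mul_of_pos_right hbud hξ2
  calc ‖W' - 1‖ ≤ ‖(I * ξ) • S'‖ + ‖W' - 1 - (I * ξ) • S'‖ := htri'
    _ < (1 + 7 * c.β) * c.L⁻¹ ^ 2 * c.α₀ * ξ ^ 2 + c.β * c.L⁻¹ ^ 2 * c.α₀ * ξ ^ 2 := add_lt_add step1 step2
    _ = (1 + 8 * c.β) * c.L⁻¹ ^ 2 * c.α₀ * ξ ^ 2 := by ring

/-- **(3.52) as printed, for the plaquette variable of `exp iξ(𝐊 + 𝐀₂)` on the lattice** (`B12Lemma4Concrete.plaq_expI_eq_holonomy`), at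
one plaquette `p = (x, μ < ν)` with the bond data at its four bonds and the two derivative pairs at `x`.
[cite: Balaban1987RG1, (3.52) p.280] -/
theorem ineq352_plaq (c : B12Sec2to5.Lemma4Consts) (hR : B12Sec2to5.Lemma4Restrictions c)
    (hB : 1 ≤ c.B₃) (hY : 1 ≤ c.B₃ ^ 2 * c.O₁ * c.M) (hα₁ : 16 * (c.O₁ * c.M * c.α₁) ≤ c.β)
    {η ξ τ n : ℝ} {j : ℕ} (hη : 0 ≤ η) (hj : 1 ≤ j) (hscale : c.L ^ j * η ≤ 1)
    (hξ : 0 < ξ) (hξ1 : ξ ≤ 1) (hξx : ξ * (c.L ^ (j - 1) * η) = c.L⁻¹ * η) (hτ0 : 0 ≤ τ) (hτ1 : τ ≤ 1) (hn : n < c.α₃)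
    {H K A : PBond P i → 𝔸} (p : Plaq P i) {ℓ : 𝔸}
    (h41 : ‖((plaq (fun b => expI ξ (H b)) p : 𝔸ˣ) : 𝔸) - 1‖ <
      Real.exp (c.B₃ ^ 2 * c.O₁ * c.M * c.α₀) * Real.exp (c.B₃ * c.O₁ * c.M * c.α₀) *
      Real.exp (c.B₃ * c.O₁ * c.M * c.α₀) * Real.exp (c.O₁ * c.M * c.α₁) *
      ((1 + 2 * c.β) * c.α₀ * (c.L⁻¹ * η) ^ 2))
    (hH₁ : ‖H ⟨p.src, p.μ⟩‖ < c.B₃ ^ 2 * c.O₁ * c.M * c.α₀ * (c.L ^ (j - 1) * η))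
    (hH₂ : ‖H ⟨p.src.shift p.μ, p.ν⟩‖ < c.B₃ ^ 2 * c.O₁ * c.M * c.α₀ * (c.L ^ (j - 1) * η))
    (hH₃ : ‖H ⟨p.src.shift p.ν, p.μ⟩‖ < c.B₃ ^ 2 * c.O₁ * c.M * c.α₀ * (c.L ^ (j - 1) * η))
    (hH₄ : ‖H ⟨p.src, p.ν⟩‖ < c.B₃ ^ 2 * c.O₁ * c.M * c.α₀ * (c.L ^ (j - 1) * η))
    (h45 : ‖(ξ : ℂ)⁻¹ • (H ⟨p.src, p.μ⟩ + H ⟨p.src.shift p.μ, p.ν⟩ - H ⟨p.src.shift p.ν, p.μ⟩ - H ⟨p.src, p.ν⟩) - ℓ‖ <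
      c.B₃ * (c.B₃ * c.O₁ * c.M * c.α₀ * (c.L ^ (j - 1) * η)) ^ 2)
    (hK₁ : ‖K ⟨p.src, p.μ⟩‖ < c.B₃ ^ 2 * c.O₁ * c.M * c.α₀ * (c.L ^ (j - 1) * η))
    (hK₂ : ‖K ⟨p.src.shift p.μ, p.ν⟩‖ < c.B₃ ^ 2 * c.O₁ * c.M * c.α₀ * (c.L ^ (j - 1) * η))
    (hK₃ : ‖K ⟨p.src.shift p.ν, p.μ⟩‖ < c.B₃ ^ 2 * c.O₁ * c.M * c.α₀ * (c.L ^ (j - 1) * η))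
    (hK₄ : ‖K ⟨p.src, p.ν⟩‖ < c.B₃ ^ 2 * c.O₁ * c.M * c.α₀ * (c.L ^ (j - 1) * η))
    (h45τ : ‖(ξ : ℂ)⁻¹ • (K ⟨p.src, p.μ⟩ + K ⟨p.src.shift p.μ, p.ν⟩ - K ⟨p.src.shift p.ν, p.μ⟩ - K ⟨p.src, p.ν⟩) -
      (τ : ℂ) • ℓ‖ < c.B₃ * (c.B₃ * c.O₁ * c.M * c.α₀ * (c.L ^ (j - 1) * η)) ^ 2)
    (hA₁ : ‖A ⟨p.src, p.μ⟩‖ ≤ c.B₃ * n) (hA₂ : ‖A ⟨p.src.shift p.μ, p.ν⟩‖ ≤ c.B₃ * n)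
    (hA₃ : ‖A ⟨p.src.shift p.ν, p.μ⟩‖ ≤ c.B₃ * n) (hA₄ : ‖A ⟨p.src, p.ν⟩‖ ≤ c.B₃ * n)
    (hdμ : ‖grad ξ p.μ (fun y => A ⟨y, p.ν⟩) p.src‖ ≤ c.B₃ * n) (hdν : ‖grad ξ p.ν (fun y => A ⟨y, p.μ⟩) p.src‖ ≤ c.B₃ * n) :
    ‖((plaq (fun b => expI ξ (K b + A b)) p : 𝔸ˣ) : 𝔸) - 1‖ < (1 + 8 * c.β) * c.L⁻¹ ^ 2 * c.α₀ * ξ ^ 2 := by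
  rw [plaq_expI_eq_holonomy] at h41 ⊢
  exact ineq352_plaquette c hR hB hY hα₁ hη hj hscale hξ hξ1 hξx hτ0 hτ1 h41 hH₁ hH₂ hH₃ hH₄ h45 hK₁ hK₂ hK₃ hK₄ h45τ hn
    hA₁ hA₂ hA₃ hA₄ hdμ hdν

/-- **(3.52) as printed on a set of plaquettes `Xp`** («on □̃³») whose bonds and derivative pairs lie in a region `Y` carrying the bond data
(3.37) at `Q`, `τQ` and (3.50), with the plaquette data (3.41), (3.45) at `Q`, `τQ` on `Xp`. [cite: Balaban1987RG1, (3.52) p.280] -/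
theorem ineq352_region (c : B12Sec2to5.Lemma4Consts) (hR : B12Sec2to5.Lemma4Restrictions c)
    (hB : 1 ≤ c.B₃) (hY : 1 ≤ c.B₃ ^ 2 * c.O₁ * c.M) (hα₁ : 16 * (c.O₁ * c.M * c.α₁) ≤ c.β)
    {η ξ τ n : ℝ} {j : ℕ} (hη : 0 ≤ η) (hj : 1 ≤ j) (hscale : c.L ^ j * η ≤ 1)
    (hξ : 0 < ξ) (hξ1 : ξ ≤ 1) (hξx : ξ * (c.L ^ (j - 1) * η) = c.L⁻¹ * η) (hτ0 : 0 ≤ τ) (hτ1 : τ ≤ 1) (hn : n < c.α₃)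
    {Xp : Set (Plaq P i)} {Y : Region P i}
    (hXY : ∀ p ∈ Xp, (⟨p.src, p.μ⟩ : PBond P i) ∈ Y.bonds ∧ (⟨p.src.shift p.μ, p.ν⟩ : PBond P i) ∈ Y.bonds ∧
      (⟨p.src.shift p.ν, p.μ⟩ : PBond P i) ∈ Y.bonds ∧ (⟨p.src, p.ν⟩ : PBond P i) ∈ Y.bonds ∧
      (p.src, p.μ, p.ν) ∈ Y.dpairs ∧ (p.src, p.ν, p.μ) ∈ Y.dpairs)
    {H K A : PBond P i → 𝔸} {ℓ : Plaq P i → 𝔸}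
    (h41 : ∀ p ∈ Xp, ‖((plaq (fun b => expI ξ (H b)) p : 𝔸ˣ) : 𝔸) - 1‖ <
      Real.exp (c.B₃ ^ 2 * c.O₁ * c.M * c.α₀) * Real.exp (c.B₃ * c.O₁ * c.M * c.α₀) *
      Real.exp (c.B₃ * c.O₁ * c.M * c.α₀) * Real.exp (c.O₁ * c.M * c.α₁) *
      ((1 + 2 * c.β) * c.α₀ * (c.L⁻¹ * η) ^ 2))
    (hH : ∀ b ∈ Y.bonds, ‖H b‖ < c.B₃ ^ 2 * c.O₁ * c.M * c.α₀ * (c.L ^ (j - 1) * η))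
    (h45 : ∀ p ∈ Xp, ‖(ξ : ℂ)⁻¹ • (H ⟨p.src, p.μ⟩ + H ⟨p.src.shift p.μ, p.ν⟩ - H ⟨p.src.shift p.ν, p.μ⟩ - H ⟨p.src, p.ν⟩) -
      ℓ p‖ < c.B₃ * (c.B₃ * c.O₁ * c.M * c.α₀ * (c.L ^ (j - 1) * η)) ^ 2)
    (hK : ∀ b ∈ Y.bonds, ‖K b‖ < c.B₃ ^ 2 * c.O₁ * c.M * c.α₀ * (c.L ^ (j - 1) * η))
    (h45τ : ∀ p ∈ Xp, ‖(ξ : ℂ)⁻¹ • (K ⟨p.src, p.μ⟩ + K ⟨p.src.shift p.μ, p.ν⟩ - K ⟨p.src.shift p.ν, p.μ⟩ - K ⟨p.src, p.ν⟩) -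
      (τ : ℂ) • ℓ p‖ < c.B₃ * (c.B₃ * c.O₁ * c.M * c.α₀ * (c.L ^ (j - 1) * η)) ^ 2)
    (hA : ∀ b ∈ Y.bonds, ‖A b‖ ≤ c.B₃ * n)
    (hdA : ∀ q ∈ Y.dpairs, ‖grad ξ q.2.1 (fun y => A ⟨y, q.2.2⟩) q.1‖ ≤ c.B₃ * n) :
    ∀ p ∈ Xp, ‖((plaq (fun b => expI ξ (K b + A b)) p : 𝔸ˣ) : 𝔸) - 1‖ < (1 + 8 * c.β) * c.L⁻¹ ^ 2 * c.α₀ * ξ ^ 2 := by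
  intro p hp
  obtain ⟨hb₁, hb₂, hb₃, hb₄, hd₁, hd₂⟩ := hXY p hp
  exact ineq352_plaq c hR hB hY hα₁ hη hj hscale hξ hξ1 hξx hτ0 hτ1 hn p (h41 p hp) (hH _ hb₁) (hH _ hb₂) (hH _ hb₃)
    (hH _ hb₄) (h45 p hp) (hK _ hb₁) (hK _ hb₂) (hK _ hb₃) (hK _ hb₄) (h45τ p hp) (hA _ hb₁) (hA _ hb₂) (hA _ hb₃) (hA _ hb₄)
    (hdA _ hd₁) (hdA _ hd₂)

/-! ## §2. The J-budget below the same count `1+8β` -/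

omit [NormedAlgebra ℂ 𝔸] [CompleteSpace 𝔸] [NormedRing 𝔸] in
/-- **The J-budget is `< (1+8β)L⁻²α₀`** (the step of `B12CondIIIJ.jBudget_lt` before its closing `≤ α₀`): for `1 < L`, `0 < α₀`, `0 ≤ β`,
`0 ≤ x ≤ L⁻¹` and `B₃″α₃ ≤ βL⁻²α₀`. [cite: Balaban1987RG1, (3.52) p.280] -/
theorem jBudget_lt_352 {β α₀ L x B₃'' α₃ : ℝ} (hL : 1 < L) (hα₀ : 0 < α₀) (hβ : 0 ≤ β) (hx0 : 0 ≤ x) (hx : x ≤ L⁻¹)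
    (hres'' : B₃'' * α₃ ≤ β * L⁻¹ ^ 2 * α₀) :
    (1 + 3 * β) * α₀ * x ^ 3 + 3 * β * α₀ * x ^ 2 + B₃'' * α₃ + β * L⁻¹ ^ 2 * α₀ < (1 + 8 * β) * L⁻¹ ^ 2 * α₀ := by
  have hLpos : 0 < L := by linarith
  have hLinv : L⁻¹ < 1 := inv_lt_one_of_one_lt₀ hL
  have hLinv0 : 0 < L⁻¹ := inv_pos.mpr hLpos
  have hLinv2 : 0 < L⁻¹ ^ 2 := pow_pos hLinv0 2
  have hx2 : x ^ 2 ≤ L⁻¹ ^ 2 := B12CondIIIJ.sq_le_of_scale hx0 hx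
  have hx3 : x ^ 3 ≤ L⁻¹ * x ^ 2 := B12CondIIIJ.cube_le_of_scale hx0 hx
  have hc : 0 < (1 + 3 * β) * α₀ := mul_pos (by linarith) hα₀
  have s1 : (1 + 3 * β) * α₀ * x ^ 3 ≤ (1 + 3 * β) * α₀ * (L⁻¹ * x ^ 2) :=
    mul_le_mul_of_nonneg_left hx3 hc.le
  have s2 : (1 + 3 * β) * α₀ * (L⁻¹ * x ^ 2) ≤ (1 + 3 * β) * α₀ * (L⁻¹ * L⁻¹ ^ 2) :=
    mul_le_mul_of_nonneg_left (mul_le_mul_of_nonneg_left hx2 hLinv0.le) hc.le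
  have s3 : (1 + 3 * β) * α₀ * (L⁻¹ * L⁻¹ ^ 2) < (1 + 3 * β) * α₀ * L⁻¹ ^ 2 := by
    have h' : L⁻¹ * L⁻¹ ^ 2 < 1 * L⁻¹ ^ 2 := mul_lt_mul_of_pos_right hLinv hLinv2
    rw [one_mul] at h'
    exact mul_lt_mul_of_pos_left h' hc
  have h3β : 0 ≤ 3 * β * α₀ := mul_nonneg (mul_nonneg (by norm_num) hβ) hα₀.le
  have s4 : 3 * β * α₀ * x ^ 2 ≤ 3 * β * α₀ * L⁻¹ ^ 2 := mul_le_mul_of_nonneg_left hx2 h3β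
  have e : (1 + 3 * β) * α₀ * L⁻¹ ^ 2 + 3 * β * α₀ * L⁻¹ ^ 2 + β * L⁻¹ ^ 2 * α₀ + β * L⁻¹ ^ 2 * α₀
      = (1 + 8 * β) * L⁻¹ ^ 2 * α₀ := by ring
  linarith

omit [NormedAlgebra ℂ 𝔸] [CompleteSpace 𝔸] [NormedRing 𝔸] in
/-- The same over the typed constants, at `x = L^{j−1}η` (`1 ≤ j`, `L^jη ≤ 1`). [cite: Balaban1987RG1, (3.52) p.280] -/
theorem jBudget_lt_352_of_restrictions (c : B12Sec2to5.Lemma4Consts) (hR : B12Sec2to5.Lemma4Restrictions c)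
    {B₃'' η : ℝ} {j : ℕ} (hη : 0 ≤ η) (hj : 1 ≤ j) (hscale : c.L ^ j * η ≤ 1)
    (hres'' : B₃'' * c.α₃ ≤ c.β * c.L⁻¹ ^ 2 * c.α₀) :
    (1 + 3 * c.β) * c.α₀ * (c.L ^ (j - 1) * η) ^ 3 + 3 * c.β * c.α₀ * (c.L ^ (j - 1) * η) ^ 2 + B₃'' * c.α₃ +
      c.β * c.L⁻¹ ^ 2 * c.α₀ < (1 + 8 * c.β) * c.L⁻¹ ^ 2 * c.α₀ := by
  unfold B12Sec2to5.Lemma4Restrictions at hR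
  obtain ⟨hα₀, _, _, _, hβ, _, _, hL1, _, _, _, _, _, _⟩ := hR
  have hLpos : 0 < c.L := by linarith
  exact jBudget_lt_352 hL1 hα₀ hβ.le (B12CondIIIJ.scale_nonneg j hLpos hη) (B12CondIIIJ.scale_le hLpos hη hj hscale) hres''

/-! ## §3. Condition (iv) for the Lemma-4 configuration `V = exp iξ(𝐊 + 𝐀₂)`, derived -/

variable (𝓜 : Model 𝔸)

/-- **Condition (iv) (1.16) for `V = exp iξ(𝐇_j(□₀, τQ(…)) + 𝐀₂)`, DERIVED** («The condition (iv) follows from the corresponding identity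
(3.38)»): from the Lemma-4 inputs giving (3.52) on the plaquettes of `X` ((3.41) literal, (3.37) at `Q`/`τQ`, (3.45) at both, (3.50) on a
region `Y` = □̃³), the J-budget bound for the concrete current `J(V) = current π ξ V` on the bonds of `X̃⁻²` (+ `B₃″α₃ ≤ βL⁻²α₀`), the
(3.38)-data of `V` (`h338`, `hJn` with `w_n = u_j·(ū_j n)⁻¹`, `|u_j|`-cost `≤ e^{B₃²O(1)Mα₀}` everywhere, `ū_j n = u_j ∘ ctr n`, `π` commuting
with `Ad`), the frame's `ξ = L⁻ʲ` (`L^jξ = 1`, `L ≥ 1`), `X̃⁻² ⊆ X` (plaquettes), and `Lemma4Restrictions` + the unlisted constant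
hypotheses + the located `1 + 10β ≤ L²`. [cite: Balaban1987RG1, Lemma 4 (3.53) p.280 with (3.38) p.278] -/
theorem condIV_lemma4_of_eq338 (c : B12Sec2to5.Lemma4Consts) (hR : B12Sec2to5.Lemma4Restrictions c)
    (hB : 1 ≤ c.B₃) (hY : 1 ≤ c.B₃ ^ 2 * c.O₁ * c.M) (hα₁ : 16 * (c.O₁ * c.M * c.α₁) ≤ c.β) (hL10 : 1 + 10 * c.β ≤ c.L ^ 2)
    {F : Frame P i 𝔸} {cs : StepConsts} (hξ : 0 < cs.ξ) (hξ1 : cs.ξ ≤ 1) (hL : 1 ≤ cs.L) (hLξ : cs.L ^ cs.j * cs.ξ = 1)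
    {η τ n B₃'' : ℝ} {j : ℕ} (hη : 0 ≤ η) (hj : 1 ≤ j) (hscale : c.L ^ j * η ≤ 1)
    (hξx : cs.ξ * (c.L ^ (j - 1) * η) = c.L⁻¹ * η) (hτ0 : 0 ≤ τ) (hτ1 : τ ≤ 1) (hn : n < c.α₃)
    (hres'' : B₃'' * c.α₃ ≤ c.β * c.L⁻¹ ^ 2 * c.α₀) (π : 𝔸 →ₗ[ℂ] 𝔸) (hπR : ∀ (g : 𝔸ˣ) (X : 𝔸), π (R g X) = R g (π X))
    {Y : Region P i} (hX₂p : F.X₂.plaqs ⊆ F.X.plaqs)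
    (hXp : ∀ p ∈ F.X.plaqs, (⟨p.src, p.μ⟩ : PBond P i) ∈ Y.bonds ∧ (⟨p.src.shift p.μ, p.ν⟩ : PBond P i) ∈ Y.bonds ∧
      (⟨p.src.shift p.ν, p.μ⟩ : PBond P i) ∈ Y.bonds ∧ (⟨p.src, p.ν⟩ : PBond P i) ∈ Y.bonds ∧
      (p.src, p.μ, p.ν) ∈ Y.dpairs ∧ (p.src, p.ν, p.μ) ∈ Y.dpairs)
    {H K A : PBond P i → 𝔸} {ℓ : Plaq P i → 𝔸}
    (h41 : ∀ p ∈ F.X.plaqs, ‖((plaq (fun b => expI cs.ξ (H b)) p : 𝔸ˣ) : 𝔸) - 1‖ <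
      Real.exp (c.B₃ ^ 2 * c.O₁ * c.M * c.α₀) * Real.exp (c.B₃ * c.O₁ * c.M * c.α₀) *
      Real.exp (c.B₃ * c.O₁ * c.M * c.α₀) * Real.exp (c.O₁ * c.M * c.α₁) *
      ((1 + 2 * c.β) * c.α₀ * (c.L⁻¹ * η) ^ 2))
    (hH : ∀ b ∈ Y.bonds, ‖H b‖ < c.B₃ ^ 2 * c.O₁ * c.M * c.α₀ * (c.L ^ (j - 1) * η))
    (h45 : ∀ p ∈ F.X.plaqs, ‖(cs.ξ : ℂ)⁻¹ • (H ⟨p.src, p.μ⟩ + H ⟨p.src.shift p.μ, p.ν⟩ - H ⟨p.src.shift p.ν, p.μ⟩ -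
      H ⟨p.src, p.ν⟩) - ℓ p‖ < c.B₃ * (c.B₃ * c.O₁ * c.M * c.α₀ * (c.L ^ (j - 1) * η)) ^ 2)
    (hK : ∀ b ∈ Y.bonds, ‖K b‖ < c.B₃ ^ 2 * c.O₁ * c.M * c.α₀ * (c.L ^ (j - 1) * η))
    (h45τ : ∀ p ∈ F.X.plaqs, ‖(cs.ξ : ℂ)⁻¹ • (K ⟨p.src, p.μ⟩ + K ⟨p.src.shift p.μ, p.ν⟩ - K ⟨p.src.shift p.ν, p.μ⟩ -
      K ⟨p.src, p.ν⟩) - (τ : ℂ) • ℓ p‖ < c.B₃ * (c.B₃ * c.O₁ * c.M * c.α₀ * (c.L ^ (j - 1) * η)) ^ 2)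
    (hA : ∀ b ∈ Y.bonds, ‖A b‖ ≤ c.B₃ * n)
    (hdA : ∀ q ∈ Y.dpairs, ‖grad cs.ξ q.2.1 (fun y => A ⟨y, q.2.2⟩) q.1‖ ≤ c.B₃ * n)
    (hJ₂ : ∀ b ∈ F.X₂.bonds, ‖current π cs.ξ (fun b => expI cs.ξ (K b + A b)) b‖ <
      (1 + 3 * c.β) * c.α₀ * (c.L ^ (j - 1) * η) ^ 3 + 3 * c.β * c.α₀ * (c.L ^ (j - 1) * η) ^ 2 + B₃'' * c.α₃ +
        c.β * c.L⁻¹ ^ 2 * c.α₀)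
    {uj : Site P i → 𝔸ˣ} {ubar : ℕ → Site P i → 𝔸ˣ} {ctr : ℕ → Site P i → Site P i}
    (huj : ∀ y, ‖(uj y : 𝔸)‖ * ‖(↑(uj y)⁻¹ : 𝔸)‖ ≤ Real.exp (c.B₃ ^ 2 * c.O₁ * c.M * c.α₀))
    (hubar : ∀ n x, ubar n x = uj (ctr n x))
    (h338 : ∀ m, 1 ≤ m → m ≤ cs.j → ∀ p ∈ F.X₂.plaqs, plaq (F.bg.Un m (fun b => expI cs.ξ (K b + A b))) p =
      plaq (gaugeU (uj * (ubar m)⁻¹) (fun b => expI cs.ξ (K b + A b))) p)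
    (hJn : ∀ m, 1 ≤ m → m ≤ cs.j → ∀ b ∈ F.X₂.bonds, F.bg.Jn m (fun b => expI cs.ξ (K b + A b)) b =
      current π (cs.L ^ m)⁻¹ (gaugeU (uj * (ubar m)⁻¹) (fun b => expI cs.ξ (K b + A b))) b) :
    CondIV F.bg F.X₂ cs c.α₀ (fun b => expI cs.ξ (K b + A b)) := by
  have hmargin := margin352_of_restrictions c hR hY hL10
  have hE : 0 < Real.exp (c.B₃ ^ 2 * c.O₁ * c.M * c.α₀) * Real.exp (c.B₃ ^ 2 * c.O₁ * c.M * c.α₀) := by positivity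
  have h52 := ineq352_region c hR hB hY hα₁ hη hj hscale hξ hξ1 hξx hτ0 hτ1 hn hXp h41 hH h45 hK h45τ hA hdA
  have hbud := jBudget_lt_352_of_restrictions c hR hη hj hscale hres''
  refine condIV_of_eq338 π (w := fun m => uj * (ubar m)⁻¹) hξ hL hLξ h338 hJn (fun m x X => hπR _ X)
    (fun m x => cost_mul_inv_le huj (hubar m) x) hE (fun p hp => ?_) hmargin (fun b hb => (hJ₂ b hb).trans hbud) hmargin
  have h := h52 p (hX₂p hp)
  calc _ < (1 + 8 * c.β) * c.L⁻¹ ^ 2 * c.α₀ * cs.ξ ^ 2 := h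
    _ = _ := by ring

/-! ## §4. Lemma 4 for the printed pair `(V, J(V))` with (iv) and the J-half derived -/

/-- **Lemma 4, membership of the printed pair `(𝐔, J(𝐔))`, `𝐔 = exp iξ(𝐇_j(□₀, τQ(…)) + 𝐀₂)`, in `U^c_j(X, α₀, α₁)` — with condition (iv)
for `𝐔` and for `U = 1` DERIVED from the (3.38)-data and the J-half of (iii) from the J-budget** — `B12Lemma4Space.ofBackground_mem_space'_lemma4`
with `hIV`, `hIV₁`, `hJ` replaced by: ONE J-budget hypothesis for `J(𝐔) = current π ξ 𝐔` on a region `Y` (□̃³) containing the bonds of `X` and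
of `X̃⁻²` (`B12CondIIIJ.condIII_second_of_restrictions` closes (iii), §3 closes (iv)), the (3.38)-data of `𝐔` (with `u_j`, `ū_j`) and of
`1` (pure gauge `1^{w}`), `π` commuting with `Ad` of all units, `ξ = L⁻ʲ` of the frame, `X̃⁻² ⊆ X`, and the located extra restriction
`1 + 10β ≤ L²` (GAPS G-B12-03). [cite: Balaban1987RG1, Lemma 4 (3.53) p.280 with (3.38) p.278 and (1.8)–(1.9) p.261] -/
theorem ofBackground_mem_space'_lemma4_of_eq338 (c : B12Sec2to5.Lemma4Consts) (hR : B12Sec2to5.Lemma4Restrictions c)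
    (hB : 1 ≤ c.B₃) (hY : 1 ≤ c.B₃ ^ 2 * c.O₁ * c.M) (hα₁ : 16 * (c.O₁ * c.M * c.α₁) ≤ c.β) (hL10 : 1 + 10 * c.β ≤ c.L ^ 2)
    {F : Frame P i 𝔸} {cs : StepConsts} (hξ : 0 < cs.ξ) (hξ1 : cs.ξ ≤ 1) (hcB : 0 < cs.cB)
    (hL : 1 ≤ cs.L) (hLξ : cs.L ^ cs.j * cs.ξ = 1)
    {η τ n B₃'' : ℝ} {j : ℕ} (hη : 0 ≤ η) (hj : 1 ≤ j) (hscale : c.L ^ j * η ≤ 1)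
    (hξx : cs.ξ * (c.L ^ (j - 1) * η) = c.L⁻¹ * η) (hτ0 : 0 ≤ τ) (hτ1 : τ ≤ 1) (hn : n < c.α₃)
    (hres'' : B₃'' * c.α₃ ≤ c.β * c.L⁻¹ ^ 2 * c.α₀)
    (heGc : ∀ A ∈ 𝓜.gc, expI cs.ξ A ∈ 𝓜.Gc) (π : 𝔸 →ₗ[ℂ] 𝔸) (hπ : ∀ X, π X ∈ 𝓜.gc)
    (hgc : ∀ g ∈ 𝓜.Gc, ∀ X ∈ 𝓜.gc, R g X ∈ 𝓜.gc) (hπR : ∀ (g : 𝔸ˣ) (X : 𝔸), π (R g X) = R g (π X))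
    {Y : Region P i} (hXb : F.X.bonds ⊆ Y.bonds) (hXd : F.X.dpairs ⊆ Y.dpairs) (hX₂b : F.X₂.bonds ⊆ Y.bonds)
    (hX₂p : F.X₂.plaqs ⊆ F.X.plaqs)
    (hXp : ∀ p ∈ F.X.plaqs, (⟨p.src, p.μ⟩ : PBond P i) ∈ Y.bonds ∧ (⟨p.src.shift p.μ, p.ν⟩ : PBond P i) ∈ Y.bonds ∧
      (⟨p.src.shift p.ν, p.μ⟩ : PBond P i) ∈ Y.bonds ∧ (⟨p.src, p.ν⟩ : PBond P i) ∈ Y.bonds ∧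
      (p.src, p.μ, p.ν) ∈ Y.dpairs ∧ (p.src, p.ν, p.μ) ∈ Y.dpairs)
    {H K A : PBond P i → 𝔸} {ℓ : Plaq P i → 𝔸} (hKgc : ∀ b, K b ∈ 𝓜.gc) (hAgc : ∀ b, A b ∈ 𝓜.gc)
    (h41 : ∀ p ∈ F.X.plaqs, ‖((plaq (fun b => expI cs.ξ (H b)) p : 𝔸ˣ) : 𝔸) - 1‖ <
      Real.exp (c.B₃ ^ 2 * c.O₁ * c.M * c.α₀) * Real.exp (c.B₃ * c.O₁ * c.M * c.α₀) *
      Real.exp (c.B₃ * c.O₁ * c.M * c.α₀) * Real.exp (c.O₁ * c.M * c.α₁) *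
      ((1 + 2 * c.β) * c.α₀ * (c.L⁻¹ * η) ^ 2))
    (hH : ∀ b ∈ Y.bonds, ‖H b‖ < c.B₃ ^ 2 * c.O₁ * c.M * c.α₀ * (c.L ^ (j - 1) * η))
    (h45 : ∀ p ∈ F.X.plaqs, ‖(cs.ξ : ℂ)⁻¹ • (H ⟨p.src, p.μ⟩ + H ⟨p.src.shift p.μ, p.ν⟩ - H ⟨p.src.shift p.ν, p.μ⟩ -
      H ⟨p.src, p.ν⟩) - ℓ p‖ < c.B₃ * (c.B₃ * c.O₁ * c.M * c.α₀ * (c.L ^ (j - 1) * η)) ^ 2)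
    (hK : ∀ b ∈ Y.bonds, ‖K b‖ < c.B₃ ^ 2 * c.O₁ * c.M * c.α₀ * (c.L ^ (j - 1) * η))
    (hK1 : ∀ q ∈ Y.dpairs, ‖grad cs.ξ q.2.1 (fun y => K ⟨y, q.2.2⟩) q.1‖ < c.B₃ ^ 2 * c.O₁ * c.M * c.α₀ * (c.L ^ (j - 1) * η))
    (h45τ : ∀ p ∈ F.X.plaqs, ‖(cs.ξ : ℂ)⁻¹ • (K ⟨p.src, p.μ⟩ + K ⟨p.src.shift p.μ, p.ν⟩ - K ⟨p.src.shift p.ν, p.μ⟩ -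
      K ⟨p.src, p.ν⟩) - (τ : ℂ) • ℓ p‖ < c.B₃ * (c.B₃ * c.O₁ * c.M * c.α₀ * (c.L ^ (j - 1) * η)) ^ 2)
    (hA : ∀ b ∈ Y.bonds, ‖A b‖ ≤ c.B₃ * n)
    (hdA : ∀ q ∈ Y.dpairs, ‖grad cs.ξ q.2.1 (fun y => A ⟨y, q.2.2⟩) q.1‖ ≤ c.B₃ * n)
    (hJY : ∀ b ∈ Y.bonds, ‖current π cs.ξ (fun b => expI cs.ξ (K b + A b)) b‖ <
      (1 + 3 * c.β) * c.α₀ * (c.L ^ (j - 1) * η) ^ 3 + 3 * c.β * c.α₀ * (c.L ^ (j - 1) * η) ^ 2 + B₃'' * c.α₃ +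
        c.β * c.L⁻¹ ^ 2 * c.α₀)
    {uj : Site P i → 𝔸ˣ} {ubar w₁ : ℕ → Site P i → 𝔸ˣ} {ctr : ℕ → Site P i → Site P i}
    (huj : ∀ y, ‖(uj y : 𝔸)‖ * ‖(↑(uj y)⁻¹ : 𝔸)‖ ≤ Real.exp (c.B₃ ^ 2 * c.O₁ * c.M * c.α₀))
    (hubar : ∀ n x, ubar n x = uj (ctr n x))
    (h338 : ∀ m, 1 ≤ m → m ≤ cs.j → ∀ p ∈ F.X₂.plaqs, plaq (F.bg.Un m (fun b => expI cs.ξ (K b + A b))) p =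
      plaq (gaugeU (uj * (ubar m)⁻¹) (fun b => expI cs.ξ (K b + A b))) p)
    (hJn : ∀ m, 1 ≤ m → m ≤ cs.j → ∀ b ∈ F.X₂.bonds, F.bg.Jn m (fun b => expI cs.ξ (K b + A b)) b =
      current π (cs.L ^ m)⁻¹ (gaugeU (uj * (ubar m)⁻¹) (fun b => expI cs.ξ (K b + A b))) b)
    (h338₁ : ∀ m, 1 ≤ m → m ≤ cs.j → ∀ p ∈ F.X₂.plaqs,
      plaq (F.bg.Un m (1 : PBond P i → 𝔸ˣ)) p = plaq (gaugeU (w₁ m) (1 : PBond P i → 𝔸ˣ)) p)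
    (hJn₁ : ∀ m, 1 ≤ m → m ≤ cs.j → ∀ b ∈ F.X₂.bonds,
      F.bg.Jn m (1 : PBond P i → 𝔸ˣ) b = current π (cs.L ^ m)⁻¹ (gaugeU (w₁ m) (1 : PBond P i → 𝔸ˣ)) b) :
    ofBackground π cs.ξ (fun b => expI cs.ξ (K b + A b)) ∈ space' 𝓜 F cs c.α₀ c.α₁ := by
  have hα₀ : 0 < c.α₀ := by
    have hR' := hR
    unfold B12Sec2to5.Lemma4Restrictions at hR'
    exact hR'.1
  refine B12Lemma4Space.ofBackground_mem_space'_lemma4 𝓜 c hR hB hY hα₁ hξ hξ1 hcB hη hj hscale hξx hτ0 hτ1 hn heGc π hπ hgc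
    hXb hXd hXp hKgc hAgc h41 hH h45 hK hK1 h45τ hA hdA
    (fun b hb => B12CondIIIJ.condIII_second_of_restrictions c hR hη hj hscale hres'' (hJY b (hXb hb))) ?_ ?_
  · exact condIV_lemma4_of_eq338 c hR hB hY hα₁ hL10 hξ hξ1 hL hLξ hη hj hscale hξx hτ0 hτ1 hn hres'' π hπR hX₂p hXp h41
      hH h45 hK h45τ hA hdA (fun b hb => hJY b (hX₂b hb)) huj hubar h338 hJn
  · exact condIV_one_of_eq338 π hα₀ hξ hL h338₁ hJn₁ (fun m x X => hπR _ X)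

end

end Literature.MathematicalPhysics.QuantumFieldTheory.Balaban1983to89.B12Lemma4CondIV
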